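import Summits.AnomalousDissipation.AnomalousDissipation.Theses.ImpulseGrid
import Summits.AnomalousDissipation.AnomalousDissipation.Theses.Correlation
import Summits.AnomalousDissipation.AnomalousDissipation.Theorems.BaireTransferDenseLoudDesignerForcesStubUnboost
import Summits.AnomalousDissipation.AnomalousDissipation.Theorems.MarginalStabilityChainChainRealisationStubLoudOfContrast
import Literature.Analysis.FluidPDE.TorusClassicalLerayHopfProofs
import Literature.Analysis.FunctionSpaces.TorusClassicalNSGluing
import Literature.Analysis.FunctionSpaces.TorusAxisAverageCalculus
import Literature.Analysis.FunctionSpaces.TorusSpaceTimeFields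
import Literature.Analysis.FluidPDE.LongTimeAverageSubadditive
import Literature.Analysis.FluidPDE.ZerothLawProofs
import Literature.Analysis.FluidPDE.StokesTorusProofs
import HarnessLib

/-!
# Regular drift families for every grid design give the zero-momentum bounded-energy cruxes of
# route Correlation (crux stmt-AnomalousDissipation-14350, line `Sketch`: why the residual is crux-sized)

Support file for the crux `Summit.AnomalousDissipation.AnomalousDissipation.Theses.ImpulseGrid.BoundedEnergyNoLeakGrid`
(item stmt-AnomalousDissipation-14350).  The registered residual stub of the line `Sketch`,
`stub_regularDriftStatesExist` ("RegularDriftStates": for EVERY grid design `(Φ, G, c)` there are `ν_j → 0⁺`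
and eternal classical solutions of `NS_{ν_j}(Φ • G)` on `ℝ × T³` with drift datum `∫ u_j 0 = c e₀`, a per-`j`
forward kinetic-energy cap and `j`-uniformly bounded mean energy), from which the crux follows by pure
bookkeeping (`ImpulseGridBoundedEnergyNoLeakGridOfRegularDriftStates`), is shown here to IMPLY two open cruxes
of route Correlation:

* `boundedEnergyEqualityZM_of_regularDriftStates : RegularDriftStates → Correlation.BoundedEnergyEqualityZM`
  (stmt-AnomalousDissipation-14640: SOME non-zero steady force with zero-momentum vanishing-viscosity global
  Leray–Hopf families of uniformly bounded mean energy AND no Leray–Hopf leakage in the mean), and hence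
* `boundedEnergyFamilyZM_of_regularDriftStates : RegularDriftStates → Correlation.BoundedEnergyFamilyZM`
  (stmt-AnomalousDissipation-14641, "turbulent saturation at zero momentum", `Re ~ Gr^{1/2}`; Doering–Foias
  2002 §3; the steady version is listed as open in Constantin–Tarfulea–Vicol 2014, p. 3).

Mechanism (Galilean UNBOOST at the admissible design `Φ ≡ 1`, `c = 1`).  The constant unit-mass profile
`Φ ≡ 1` is admissible for every columnar transverse pattern `G` (smooth, `x₀`-invariant, `G ⊥ e₀`,
divergence free, mean zero), so `RegularDriftStates` yields lab-frame classical families `u_j` forced by the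
`x₀`-INVARIANT steady force `G` with `∫ u_j 0 = e₀`.  In the frame moving with the drift,
`v_j(t, y) := u_j(t, y + [t e₀]) − e₀` is again an eternal classical solution, forced by the swept force
`G(· + [t e₀]) = G` (`Galilean.Unboost.galilean_unboost`, landed; `x₀`-invariance), with ZERO-MOMENTUM datum
`∫ v_j 0 = ∫ u_j 0 − e₀ = 0`, per-`j` caps `kineticEnergy (v_j t) ≤ 2·kineticEnergy (u_j t) + 1` and mean
energies `⟨‖v_j‖²⟩ ≤ 2⟨‖u_j‖²⟩ + 2` (pointwise `‖a − e₀‖² ≤ 2‖a‖² + 2`, Haar invariance of the volume of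
`T³`, and the subadditivity of `limsup` long-time averages, `longTimeAvgSup_le_add_of_le_add`).  A classical
solution on `univ` is a global Leray–Hopf solution from its own slice
(`Torus.IsClassicalNSSolutionOn.isGlobalLerayHopf`) and, under a forward `L²` cap, satisfies mean energy
EQUALITY (`ChainRealisation.SeparatrixFluxPinning.meanDissipation_eq_longTimeAvgSup_inner`), in particular no
leakage.  The witness force is the gravest columnar shear pattern `G = sin(2πx₁) e₂`
(`stokesMode e₁ e₂ false`), certified smooth, `x₀`-invariant, transverse, divergence free, mean zero and
non-zero (`G(¼ e₁) = e₂`).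

So the residual of crux stmt-AnomalousDissipation-14350 is at least as strong as Correlation's cruxes
stmt-14640 ⊇ stmt-14641 (both recorded as open problems on the ledger), uniformly over the pattern `G`;
this is the formal content of "crux-sized" in the lead's notes.  No definitions, no named facts, standard
axioms.

References: U. Frisch, *Turbulence* (1995) §5.2 (Galilean invariance); C. R. Doering, C. Foias, J. Fluid
Mech. 467 (2002) §§2–3; P. Constantin, A. Tarfulea, V. Vicol, ARMA 212 (2014), p. 3; C. Foias, O. Manley,
R. Rosa, R. Temam, *Navier–Stokes Equations and Turbulence* (2001), (13.11).
-/

-- `Summit.<Summit>.<Problem>` is the tree's mandated summit-side namespace (CONVENTIONS §2); for this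
-- single-conjunct summit the two coincide, so the duplicate is deliberate.
set_option linter.dupNamespace false

noncomputable section

open MeasureTheory Filter Set
open scoped InnerProductSpace
open Literature.Analysis.FunctionSpaces Literature.Analysis.FunctionSpaces.Torus
open Literature.Analysis.FluidPDE Literature.Analysis.FluidPDE.Torus
open Summit.AnomalousDissipation.AnomalousDissipation.Theorems.DenseLoudDesignerForces.Galilean
open Summit.AnomalousDissipation.AnomalousDissipation.Theorems.ChainRealisation.SeparatrixFluxPinning

namespace Summit.AnomalousDissipation.AnomalousDissipation.Theorems

namespace RegularDriftStatesHardness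

/-! ## Long-time averages: an affine bound passes to mean energies -/

/-- **Affine comparison of mean energies.** If `v`, `u` have continuous space–time lifts, `u` has a forward
`L²` cap, and `∫‖v(t)‖² ≤ a ∫‖u(t)‖² + b` for `t > 0` (`a, b ≥ 0`), then `⟨‖v‖²⟩ ≤ a ⟨‖u‖²⟩ + b`
(`longTimeAvgSup_le_add_of_le_add`, `longTimeAvgSup_const_mul`, `longTimeAvgSup_le_const`). [folklore] -/
theorem meanEnergy_le_affine {v u : ℝ → UnitAddTorus (Fin 3) → EuclideanSpace ℝ (Fin 3)} {a b C : ℝ}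
    (ha : 0 ≤ a) (hb : 0 ≤ b)
    (hu : ContinuousOn (stLift u) (univ ×ˢ univ))
    (hC : ∀ t : ℝ, 0 ≤ t → ∫ x, ‖u t x‖ ^ 2 ≤ C)
    (hle : ∀ t : ℝ, 0 < t → ∫ x, ‖v t x‖ ^ 2 ≤ a * (∫ x, ‖u t x‖ ^ 2) + b) :
    meanEnergy v ≤ a * meanEnergy u + b := by
  rw [meanEnergy_eq_longTimeAvgSup, meanEnergy_eq_longTimeAvgSup]
  have hcont : ContinuousOn (fun t => ∫ x, ‖u t x‖ ^ 2) univ :=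
    continuousOn_integral_norm_sq_of_continuousOn_stLift hu
  have hcont' : Continuous (fun t => a * ∫ x, ‖u t x‖ ^ 2) :=
    continuous_const.mul (continuousOn_univ.1 hcont)
  have hfi : ∀ T, 0 < T → IntegrableOn (fun t => a * ∫ x, ‖u t x‖ ^ 2) (Ioc 0 T) := fun T _ =>
    (hcont'.continuousOn.integrableOn_compact isCompact_Icc).mono_set Ioc_subset_Icc_self
  have hgi : ∀ T, 0 < T → IntegrableOn (fun _ : ℝ => b) (Ioc 0 T) := fun T _ =>
    integrableOn_const (hs := measure_Ioc_lt_top.ne)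
  have hf0 : ∀ t, 0 ≤ a * ∫ x, ‖u t x‖ ^ 2 := fun t =>
    mul_nonneg ha (integral_nonneg fun _ => sq_nonneg _)
  have hmeanb : ∀ T, 0 < T → timeMean (fun _ : ℝ => b) T = b := fun T hT => by
    unfold timeMean
    rw [intervalIntegral.integral_const, smul_eq_mul, sub_zero, ← mul_assoc, inv_mul_cancel₀ hT.ne', one_mul]
  have hgb : IsBoundedUnder (· ≤ ·) atTop (timeMean fun _ : ℝ => b) :=
    ⟨b, (eventually_gt_atTop (0 : ℝ)).mono fun T hT => (hmeanb T hT).le⟩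
  -- the running means of `a ∫‖u‖²` are bounded by those of the constant `a C`
  have haC : 0 ≤ a * C := mul_nonneg ha ((integral_nonneg fun _ => sq_nonneg _).trans (hC 0 le_rfl))
  have hmeanaC : ∀ T, 0 < T → timeMean (fun _ : ℝ => a * C) T = a * C := fun T hT => by
    unfold timeMean
    rw [intervalIntegral.integral_const, smul_eq_mul, sub_zero, ← mul_assoc, inv_mul_cancel₀ hT.ne', one_mul]
  have hfb : IsBoundedUnder (· ≤ ·) atTop (timeMean fun t => a * ∫ x, ‖u t x‖ ^ 2) :=
    isBoundedUnder_timeMean_of_le (fun _ => haC)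
      (fun T _ => integrableOn_const (hs := measure_Ioc_lt_top.ne))
      (fun t ht => mul_le_mul_of_nonneg_left (hC t ht.le) ha)
      ⟨a * C, (eventually_gt_atTop (0 : ℝ)).mono fun T hT => (hmeanaC T hT).le⟩
  have h1 := longTimeAvgSup_le_add_of_le_add (fun t => integral_nonneg fun _ => sq_nonneg _) hf0
    (fun _ => hb) hfi hgi hfb hgb hle
  have h2 : longTimeAvgSup (fun t => a * ∫ x, ‖u t x‖ ^ 2) = a * longTimeAvgSup (fun t => ∫ x, ‖u t x‖ ^ 2) :=
    longTimeAvgSup_const_mul ha _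
  have h3 : longTimeAvgSup (fun _ : ℝ => b) ≤ b :=
    longTimeAvgSup_le_const (fun _ => hb) fun _ _ => le_rfl
  linarith

/-! ## The Galilean unboost of a lab-frame drift family under a columnar force -/

/-- **Unboost of a drift family** (columnar force, drift `e₀`).  Let `G` be smooth and `x₀`-invariant and
let `(u_j, p_j)` be eternal classical solutions of `NS_{ν_j}(G)` with `∫ u_j 0 = e₀`, per-`j` forward
kinetic-energy caps and mean energies `≤ E`.  Then `v_j(t, y) := u_j(t, y + [t e₀]) − e₀`,
`q_j(t, y) := p_j(t, y + [t e₀])` are eternal classical solutions of `NS_{ν_j}(G)` (`galilean_unboost`; the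
swept force `G(· + [t e₀])` is `G`) with zero-momentum data, per-`j` caps and mean energies `≤ 2E + 2`.
[folklore] -/
theorem unboost_family {G : UnitAddTorus (Fin 3) → EuclideanSpace ℝ (Fin 3)}
    (hGinv : ∀ (s : UnitAddCircle) x, G (x + Pi.single (0 : Fin 3) s) = G x)
    {ν : ℕ → ℝ} {u : ℕ → ℝ → UnitAddTorus (Fin 3) → EuclideanSpace ℝ (Fin 3)}
    {p : ℕ → ℝ → UnitAddTorus (Fin 3) → ℝ}
    (hcl : ∀ j, IsClassicalNSSolutionOn Set.univ (ν j) (fun _ => G) (u j) (p j))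
    (hdat : ∀ j, ∫ x, u j 0 x = EuclideanSpace.single (0 : Fin 3) (1 : ℝ))
    (hcap : ∀ j, ∃ C : ℝ, ∀ t : ℝ, 0 ≤ t → kineticEnergy (u j t) ≤ C)
    {E : ℝ} (hE : ∀ j, meanEnergy (u j) ≤ E) :
    ∃ (v : ℕ → ℝ → UnitAddTorus (Fin 3) → EuclideanSpace ℝ (Fin 3)) (q : ℕ → ℝ → UnitAddTorus (Fin 3) → ℝ),
      (∀ j, IsClassicalNSSolutionOn Set.univ (ν j) (fun _ => G) (v j) (q j)) ∧
      (∀ j, HasZeroMean (v j 0)) ∧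
      (∀ j, ∃ C : ℝ, ∀ t : ℝ, 0 ≤ t → kineticEnergy (v j t) ≤ C) ∧
      (∀ j, meanEnergy (v j) ≤ 2 * E + 2) := by
  set V : EuclideanSpace ℝ (Fin 3) := EuclideanSpace.single (0 : Fin 3) (1 : ℝ) with hV
  have hVn : ‖V‖ = 1 := by rw [hV]; simp
  have hswept : sweptForce V G = fun _ => G := by
    funext t y
    show G (y + Torus.proj (t • V)) = G y
    rw [hV, proj_smul_single, hGinv]
  set v : ℕ → ℝ → UnitAddTorus (Fin 3) → EuclideanSpace ℝ (Fin 3) :=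
    fun j t y => u j t (y + Torus.proj (t • V)) - V with hv
  set q : ℕ → ℝ → UnitAddTorus (Fin 3) → ℝ := fun j t y => p j t (y + Torus.proj (t • V)) with hq
  have hvcl : ∀ j, IsClassicalNSSolutionOn Set.univ (ν j) (fun _ => G) (v j) (q j) := fun j => by
    have h := Unboost.galilean_unboost (ν j) V G (u j) (p j) (hcl j)
    rw [hswept] at h
    exact h
  -- pointwise slice bound `‖a - V‖² ≤ 2‖a‖² + 2`
  have hpt : ∀ a : EuclideanSpace ℝ (Fin 3), ‖a - V‖ ^ 2 ≤ 2 * ‖a‖ ^ 2 + 2 := fun a => by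
    have h1 : ‖a - V‖ ^ 2 ≤ (‖a‖ + ‖V‖) ^ 2 := pow_le_pow_left₀ (norm_nonneg _) (norm_sub_le a V) 2
    have h2 : (‖a‖ + ‖V‖) ^ 2 ≤ 2 * (‖a‖ ^ 2 + ‖V‖ ^ 2) := add_sq_le
    rw [hVn] at h1 h2
    simp only [one_pow] at h2
    linarith
  -- slice `L²` comparison `∫‖v t‖² ≤ 2∫‖u t‖² + 2`
  have hslice : ∀ j t, ∫ y, ‖v j t y‖ ^ 2 ≤ 2 * (∫ x, ‖u j t x‖ ^ 2) + 2 := fun j t => by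
    have hut : IsSmooth (u j t) := (hcl j).smooth_velocity.isSmooth_slice (Set.mem_univ t)
    have h1 : ∫ y, ‖v j t y‖ ^ 2 = ∫ y, ‖u j t y - V‖ ^ 2 :=
      integral_add_right_eq_self (μ := (volume : Measure (UnitAddTorus (Fin 3))))
        (fun y => ‖u j t y - V‖ ^ 2) (Torus.proj (t • V))
    have hiL : Integrable (fun y => ‖u j t y - V‖ ^ 2) (volume : Measure (UnitAddTorus (Fin 3))) :=
      (hut.sub (isSmooth_const V)).norm_sq.integrable
    have hiR : Integrable (fun y => 2 * ‖u j t y‖ ^ 2 + 2) (volume : Measure (UnitAddTorus (Fin 3))) :=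
      (hut.norm_sq.integrable.const_mul 2).add (integrable_const _)
    have h2 : ∫ y, ‖u j t y - V‖ ^ 2 ≤ ∫ y, (2 * ‖u j t y‖ ^ 2 + 2) := integral_mono hiL hiR fun y => hpt _
    have h3 : ∫ y, (2 * ‖u j t y‖ ^ 2 + 2) = 2 * (∫ y, ‖u j t y‖ ^ 2) + 2 := by
      rw [integral_add (hut.norm_sq.integrable.const_mul 2) (integrable_const _), integral_const_mul,
        integral_const, probReal_univ, one_smul]
    linarith
  refine ⟨v, q, hvcl, fun j => ?_, fun j => ?_, fun j => ?_⟩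
  · -- zero momentum of the datum
    have hu0 : IsSmooth (u j 0) := (hcl j).smooth_velocity.isSmooth_slice (Set.mem_univ 0)
    show ∫ y, (u j 0 (y + Torus.proj ((0 : ℝ) • V)) - V) = 0
    simp only [zero_smul, Torus.proj_zero, add_zero]
    rw [integral_sub hu0.integrable (integrable_const V), integral_const, probReal_univ, one_smul, hdat j,
      sub_self]
  · -- per-`j` cap
    obtain ⟨C, hC⟩ := hcap j
    refine ⟨2 * C + 1, fun t ht => ?_⟩
    have h1 := hslice j t
    have h2 := hC t ht
    unfold kineticEnergy at h1 h2 ⊢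
    linarith
  · -- mean energy
    obtain ⟨C, hC⟩ := hcap j
    have hC' : ∀ t : ℝ, 0 ≤ t → ∫ x, ‖u j t x‖ ^ 2 ≤ 2 * C := fun t ht => by
      have h2 := hC t ht
      unfold kineticEnergy at h2
      linarith
    have h := meanEnergy_le_affine (v := v j) (by norm_num : (0 : ℝ) ≤ 2) (by norm_num : (0 : ℝ) ≤ 2)
      (hcl j).smooth_velocity.continuousOn_stLift hC' (fun t _ => hslice j t)
    linarith [hE j]

/-! ## The witness pattern: the gravest columnar shear `G = sin(2πx₁) e₂` -/

/-- A character `e_k` is invariant under translations along the `i`-th circle when `kᵢ = 0`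
(verbatim `AcdcDesign.mFourier_add_single_of_apply_eq_zero` of `ImpulseGridGridThesisStubAcdcDesignCalculus`,
re-derived privately so that this file's import closure stays small). [folklore] -/
private theorem mFourier_add_single_of_apply_eq_zero' {k : Fin 3 → ℤ} {i : Fin 3} (hk : k i = 0)
    (x : UnitAddTorus (Fin 3)) (s : UnitAddCircle) :
    UnitAddTorus.mFourier k (x + Pi.single i s) = UnitAddTorus.mFourier k x := by
  rw [mFourier_apply_add]
  suffices h : UnitAddTorus.mFourier k (Pi.single i s) = 1 by rw [h, mul_one]
  simp only [UnitAddTorus.mFourier, ContinuousMap.coe_mk]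
  refine Finset.prod_eq_one fun j _ => ?_
  by_cases hj : j = i
  · subst hj
    rw [hk]
    exact fourier_zero
  · rw [Pi.single_eq_of_ne hj]
    exact fourier_eval_zero _


/-- The gravest columnar shear pattern `G = sin(2πx₁) e₂` (`stokesMode e₁ e₂ false`) is smooth, invariant
along `x₀`, transverse (`G·e₀ = 0`), divergence free, mean zero and non-zero (`G(¼e₁) = e₂`). [folklore] -/
theorem exists_columnar_pattern :
    ∃ G : UnitAddTorus (Fin 3) → EuclideanSpace ℝ (Fin 3), IsSmooth G ∧
      (∀ (s : UnitAddCircle) x, G (x + Pi.single (0 : Fin 3) s) = G x) ∧ (∀ x, G x 0 = 0) ∧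
      IsDivFree G ∧ HasZeroMean G ∧ G ≠ 0 := by
  set k : Fin 3 → ℤ := Pi.single (1 : Fin 3) (1 : ℤ) with hk
  set a : EuclideanSpace ℝ (Fin 3) := EuclideanSpace.single (2 : Fin 3) (1 : ℝ) with ha
  refine ⟨⇑(stokesMode k a false), isSmooth_stokesMode k a false, fun s x => ?_, fun x => ?_,
    isDivFree_stokesMode ?_ false, hasZeroMean_stokesMode ?_ a false, ?_⟩
  · simp only [stokesMode_apply, mFourier_add_single_of_apply_eq_zero' (show k 0 = 0 by simp [hk])]
  · simp [stokesMode_apply, ha]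
  · rw [← sum_intCast_mul_eq_inner_latticeVec, Fin.sum_univ_three]; simp [hk, ha]
  · simp [hk]
  · -- a non-zero value at `x = ¼ e₁`
    intro h
    have hchar : (UnitAddTorus.mFourier k
        (Pi.single (1 : Fin 3) (((1 : ℝ) / 4 : ℝ) : UnitAddCircle) : UnitAddTorus (Fin 3))).im = 1 := by
      rw [show (Pi.single (1 : Fin 3) (((1 : ℝ) / 4 : ℝ) : UnitAddCircle) : UnitAddTorus (Fin 3)) =
          0 + Pi.single (1 : Fin 3) (((1 : ℝ) / 4 : ℝ) : UnitAddCircle) from (zero_add _).symm,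
        mFourier_add_single, show UnitAddTorus.mFourier k (0 : UnitAddTorus (Fin 3)) = 1 by
          simp [UnitAddTorus.mFourier], mul_one, show k 1 = 1 by simp [hk], fourier_coe_apply]
      have harg : (2 * (Real.pi : ℂ) * Complex.I * ((1 : ℤ) : ℂ) * ((((1 : ℝ) / 4 : ℝ)) : ℂ) /
          ((1 : ℝ) : ℂ)) = ((Real.pi / 2 : ℝ) : ℂ) * Complex.I := by
        push_cast
        ring
      rw [harg, Complex.exp_im]
      simp
    have hx := congrArg (fun F : UnitAddTorus (Fin 3) → EuclideanSpace ℝ (Fin 3) =>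
      F (Pi.single (1 : Fin 3) (((1 : ℝ) / 4 : ℝ) : UnitAddCircle)) 2) h
    simp only [stokesMode_apply, hchar, Pi.zero_apply] at hx
    simp [ha] at hx

end RegularDriftStatesHardness

open RegularDriftStatesHardness

/-- **`RegularDriftStates ⇒ Correlation.BoundedEnergyEqualityZM`** (the residual of crux stmt-14350, line
`Sketch`, implies Correlation's crux stmt-AnomalousDissipation-14640).  Apply the hypothesis at the admissible
design `Φ ≡ 1`, `G = sin(2πx₁) e₂`, `c = 1`; unboost the lab family (`unboost_family`); a classical solution
on `univ` is global Leray–Hopf from its slice (`Torus.IsClassicalNSSolutionOn.isGlobalLerayHopf`) and has no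
Leray–Hopf leakage under its forward cap (`meanDissipation_eq_longTimeAvgSup_inner` on `[0, ∞)`). [folklore] -/
theorem boundedEnergyEqualityZM_of_regularDriftStates :
    (∀ (Φ : UnitAddTorus (Fin 3) → ℝ) (G : UnitAddTorus (Fin 3) → EuclideanSpace ℝ (Fin 3)) (c : ℝ),
      IsSmooth Φ → IsSmooth G →
      (∀ (s : UnitAddCircle) x, Φ (x + Pi.single (1 : Fin 3) s) = Φ x ∧ Φ (x + Pi.single (2 : Fin 3) s) = Φ x) →
      (∫ x, Φ x = 1) → (∀ (s : UnitAddCircle) x, G (x + Pi.single (0 : Fin 3) s) = G x) → (∀ x, G x 0 = 0) →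
      IsSmooth (fun x => Φ x • G x) → IsDivFree (fun x => Φ x • G x) → HasZeroMean (fun x => Φ x • G x) →
      0 < c →
      ∃ (ν : ℕ → ℝ) (u : ℕ → ℝ → UnitAddTorus (Fin 3) → EuclideanSpace ℝ (Fin 3))
          (p : ℕ → ℝ → UnitAddTorus (Fin 3) → ℝ),
        (∀ j, 0 < ν j) ∧ Tendsto ν atTop (nhds 0) ∧
        (∀ j, IsClassicalNSSolutionOn Set.univ (ν j) (fun _ => fun x => Φ x • G x) (u j) (p j)) ∧
        (∀ j, ∫ x, u j 0 x = c • EuclideanSpace.single (0 : Fin 3) (1 : ℝ)) ∧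
        (∀ j, ∃ C : ℝ, ∀ t : ℝ, 0 ≤ t → kineticEnergy (u j t) ≤ C) ∧
        (∃ E : ℝ, ∀ j, meanEnergy (u j) ≤ E)) →
    Summit.AnomalousDissipation.AnomalousDissipation.Theses.Correlation.BoundedEnergyEqualityZM := by
  intro hR
  obtain ⟨G, hGs, hGinv, hG0, hGdiv, hGmean, hGne⟩ := exists_columnar_pattern
  -- the design `Φ ≡ 1`, `c = 1`
  have hF : (fun x : UnitAddTorus (Fin 3) => (1 : ℝ) • G x) = G := funext fun x => one_smul ℝ (G x)
  have hΦ1 : ∫ _ : UnitAddTorus (Fin 3), (1 : ℝ) = 1 := by rw [integral_const, probReal_univ, one_smul]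
  obtain ⟨ν, u, p, hν, hν0, hcl, hdat, hcap, E, hE⟩ := hR (fun _ => 1) G 1 (isSmooth_const _) hGs
    (fun _ _ => ⟨rfl, rfl⟩) hΦ1 hGinv hG0 (by rw [hF]; exact hGs) (by rw [hF]; exact hGdiv)
    (by rw [hF]; exact hGmean) one_pos
  rw [hF] at hcl
  simp only [one_smul] at hdat
  obtain ⟨v, q, hvcl, hv0, hvcap, hvE⟩ := unboost_family hGinv hcl hdat hcap hE
  refine ⟨G, hGs, hGdiv, hGmean, hGne, ν, fun j => v j 0, v, hν, hν0, hv0,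
    fun j => (hvcl j).isGlobalLerayHopf, ⟨2 * E + 2, hvE⟩, fun j => ?_⟩
  obtain ⟨C, hC⟩ := hvcap j
  have hC' : ∀ t : ℝ, 0 ≤ t → ∫ x, ‖v j t x‖ ^ 2 ≤ 2 * C := fun t ht => by
    have h1 := hC t ht
    unfold kineticEnergy at h1
    linarith
  exact (meanDissipation_eq_longTimeAvgSup_inner ((hvcl j).mono (subset_univ _) (uniqueDiffOn_Ici 0))
    hGs hC').symm.le

/-- **`RegularDriftStates ⇒ Correlation.BoundedEnergyFamilyZM`** (Correlation's crux stmt-AnomalousDissipation-14641,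
turbulent saturation at zero momentum): drop the no-leak clause of `boundedEnergyEqualityZM_of_regularDriftStates`.
[folklore] -/
theorem boundedEnergyFamilyZM_of_regularDriftStates :
    (∀ (Φ : UnitAddTorus (Fin 3) → ℝ) (G : UnitAddTorus (Fin 3) → EuclideanSpace ℝ (Fin 3)) (c : ℝ),
      IsSmooth Φ → IsSmooth G →
      (∀ (s : UnitAddCircle) x, Φ (x + Pi.single (1 : Fin 3) s) = Φ x ∧ Φ (x + Pi.single (2 : Fin 3) s) = Φ x) →
      (∫ x, Φ x = 1) → (∀ (s : UnitAddCircle) x, G (x + Pi.single (0 : Fin 3) s) = G x) → (∀ x, G x 0 = 0) →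
      IsSmooth (fun x => Φ x • G x) → IsDivFree (fun x => Φ x • G x) → HasZeroMean (fun x => Φ x • G x) →
      0 < c →
      ∃ (ν : ℕ → ℝ) (u : ℕ → ℝ → UnitAddTorus (Fin 3) → EuclideanSpace ℝ (Fin 3))
          (p : ℕ → ℝ → UnitAddTorus (Fin 3) → ℝ),
        (∀ j, 0 < ν j) ∧ Tendsto ν atTop (nhds 0) ∧
        (∀ j, IsClassicalNSSolutionOn Set.univ (ν j) (fun _ => fun x => Φ x • G x) (u j) (p j)) ∧
        (∀ j, ∫ x, u j 0 x = c • EuclideanSpace.single (0 : Fin 3) (1 : ℝ)) ∧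
        (∀ j, ∃ C : ℝ, ∀ t : ℝ, 0 ≤ t → kineticEnergy (u j t) ≤ C) ∧
        (∃ E : ℝ, ∀ j, meanEnergy (u j) ≤ E)) →
    Summit.AnomalousDissipation.AnomalousDissipation.Theses.Correlation.BoundedEnergyFamilyZM := by
  intro hR
  obtain ⟨f, hfs, hfdiv, hfmean, hfne, ν, u₀, u, hν, hν0, hzm, hLH, hE, _⟩ :=
    boundedEnergyEqualityZM_of_regularDriftStates hR
  exact ⟨f, hfs, hfdiv, hfmean, hfne, ν, u₀, u, hν, hν0, hzm, hLH, hE⟩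

end Summit.AnomalousDissipation.AnomalousDissipation.Theorems

end
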